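import Summits.QuantumAdvantage.QuantumAdvantage.Theorems.MobiusLadderLiouvilleNotPPolyTwinKernel
import Literature.NumberTheory.LFunctions.SiegelTheorem
import Literature.NumberTheory.LFunctions.SiegelAbelSummation
import Literature.NumberTheory.QuadraticFields.KroneckerCharacterFourProofs

/-!
# Stub `stub_twinFreeSublinear` (T2c of line `Sketch`, crux `MobiusLadder.LiouvilleNotPPoly`,
stmt-QuantumAdvantage-1389)

NO LIOUVILLE TWIN OF LEVEL `2^n` HAS FEWER THAN `c·n` BITS (`c < 1`), EVENTUALLY IN `n`. A
*Liouville twin of level `x`* is an integer `d` with `(d | p) = −1` at every odd prime `p ≤ x`.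
Given the two sibling statements as hypotheses —

* (hA) the divisor sums `∑_{m ≤ N} ∑_{e ∣ m} χ(e)` of the Kronecker character `χ` mod `4|d|` of a
  twin are `≤ (log₂ N + 1)(⌊√N⌋ + 1)` for `N ≤ x` (they count odd squares);
* (hH) Dirichlet's hyperbola estimate `‖∑_{m ≤ N} ∑_{e ∣ m} χ(e) − N·L(1,χ)‖ ≤ 4BN/Y + Y` for a
  non-principal `χ` with character sums bounded by `B` and `1 ≤ Y ≤ N` —

and the tree's PROVED Siegel theorem `L(1,χ) ≥ C(ε) q^{−ε}` for quadratic `χ ≠ 1`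
(`Literature.NumberTheory.LFunctions.Siegel.siegel_theorem_quadratic`), a twin `d` of level
`N = 2^n` with `q = 4|d| ≤ 4·2^{cn}` would give, with `B = q` (MV (4.23),
`DirichletAbel.norm_partialSum_le`) and `Y = ⌊√(qN)⌋ + 1`,
`N · C q^{−ε} ≤ (n+1)(√N + 1) + 5√(qN) + 1`, i.e. `C 2^{−2ε} 2^{δ n} ≤ 2n + 13` with
`ε = (1−c)/4`, `δ = (1−c)(2−c)/4 > 0` — false for large `n`.
-/

set_option linter.dupNamespace false -- D-0017: single-problem summit ⇒ `QuantumAdvantage.QuantumAdvantage` by design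

namespace Summit.QuantumAdvantage.QuantumAdvantage.Theorems.LiouvilleNotPPoly

namespace TwinFreeSublinear

open Filter Literature.NumberTheory.LFunctions Literature.NumberTheory.QuadraticFields

/-! ### The Kronecker character of a twin is a non-principal quadratic character -/

/-- For a twin `d` of level `x ≥ 3`, a character `χ` mod `4|d|` with `χ(n) = (d | n)` at odd `n`
has `χ(3) = −1`. -/
theorem chi_apply_three {d : ℤ} {x : ℕ}
    (h : ∀ p : ℕ, p.Prime → p ≠ 2 → p ≤ x → jacobiSym d p = -1) (hx : 3 ≤ x)
    {χ : DirichletCharacter ℂ (4 * d.natAbs)} (hχ : ∀ n : ℕ, Odd n → χ n = (jacobiSym d n : ℂ)) :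
    χ (3 : ℕ) = -1 := by
  rw [hχ 3 (by decide), h 3 Nat.prime_three (by norm_num) hx]
  push_cast
  ring

/-- For a twin `d` of level `x ≥ 3`, a character `χ` mod `4|d|` with `χ(n) = (d | n)` at odd `n`
is non-principal: `χ(3) = −1`, whereas the principal character takes only the values `0, 1`. -/
theorem chi_ne_one {d : ℤ} {x : ℕ}
    (h : ∀ p : ℕ, p.Prime → p ≠ 2 → p ≤ x → jacobiSym d p = -1) (hx : 3 ≤ x)
    {χ : DirichletCharacter ℂ (4 * d.natAbs)} (hχ : ∀ n : ℕ, Odd n → χ n = (jacobiSym d n : ℂ)) :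
    χ ≠ 1 := by
  intro h1
  have h3 := chi_apply_three h hx hχ
  rw [h1] at h3
  by_cases hu : IsUnit ((3 : ℕ) : ZMod (4 * d.natAbs))
  · rw [MulChar.one_apply hu] at h3
    norm_num at h3
  · rw [MulChar.map_nonunit _ hu] at h3
    norm_num at h3

/-- For a twin `d` of level `x ≥ 3`, a character `χ` mod `4|d|` with `χ(n) = (d | n)` at odd `n`
is quadratic: `χ² = 1`. -/
theorem chi_sq_eq_one {d : ℤ} (hd0 : d ≠ 0)
    {χ : DirichletCharacter ℂ (4 * d.natAbs)} (hχ : ∀ n : ℕ, Odd n → χ n = (jacobiSym d n : ℂ)) :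
    χ ^ 2 = 1 :=
  (isQuadratic_of_forall_odd hd0 hχ).sq_eq_one

/-! ### Elementary real inequalities -/

/-- `N · re L ≤ ‖S‖ + ‖S − N·L‖` for a natural number `N`. -/
theorem natCast_mul_re_le (N : ℕ) (S L : ℂ) : (N : ℝ) * L.re ≤ ‖S‖ + ‖S - (N : ℂ) * L‖ := by
  have h1 : (N : ℝ) * L.re = S.re - (S - (N : ℂ) * L).re := by
    simp only [Complex.sub_re, Complex.mul_re, Complex.natCast_re, Complex.natCast_im, zero_mul,
      sub_zero]
    ring
  rw [h1]
  have h3 := Complex.re_le_norm S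
  have h4 := (abs_le.1 (Complex.abs_re_le_norm (S - (N : ℂ) * L))).1
  linarith

/-- The hyperbola error at `Y = ⌊√(qN)⌋ + 1`: `4qN/Y + Y ≤ 5√(qN) + 1`. -/
theorem hyperbola_error_le (q N : ℕ) :
    4 * (q : ℝ) * (N : ℝ) / ((Nat.sqrt (q * N) + 1 : ℕ) : ℝ) + ((Nat.sqrt (q * N) + 1 : ℕ) : ℝ) ≤
      5 * Real.sqrt ((q : ℝ) * (N : ℝ)) + 1 := by
  have hP : ((q * N : ℕ) : ℝ) = (q : ℝ) * (N : ℝ) := Nat.cast_mul q N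
  have hlt : Real.sqrt ((q : ℝ) * (N : ℝ)) < (Nat.sqrt (q * N) : ℝ) + 1 := by
    rw [← hP]
    exact Real.real_sqrt_lt_nat_sqrt_succ
  have hle : (Nat.sqrt (q * N) : ℝ) ≤ Real.sqrt ((q : ℝ) * (N : ℝ)) := by
    rw [← hP]
    exact Real.nat_sqrt_le_real_sqrt
  have hY : (0 : ℝ) < (Nat.sqrt (q * N) : ℝ) + 1 := by positivity
  have hP0 : (0 : ℝ) ≤ (q : ℝ) * (N : ℝ) := by positivity
  have hs : (0 : ℝ) ≤ Real.sqrt ((q : ℝ) * (N : ℝ)) := Real.sqrt_nonneg _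
  have hdiv : 4 * (q : ℝ) * (N : ℝ) / ((Nat.sqrt (q * N) : ℝ) + 1) ≤
      4 * Real.sqrt ((q : ℝ) * (N : ℝ)) := by
    rw [div_le_iff₀ hY]
    have hmul : (q : ℝ) * (N : ℝ) ≤ Real.sqrt ((q : ℝ) * (N : ℝ)) * ((Nat.sqrt (q * N) : ℝ) + 1) :=
      calc (q : ℝ) * (N : ℝ)
          = Real.sqrt ((q : ℝ) * (N : ℝ)) * Real.sqrt ((q : ℝ) * (N : ℝ)) :=
            (Real.mul_self_sqrt hP0).symm
        _ ≤ Real.sqrt ((q : ℝ) * (N : ℝ)) * ((Nat.sqrt (q * N) : ℝ) + 1) :=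
            mul_le_mul_of_nonneg_left hlt.le hs
    linarith
  push_cast
  linarith

/-! ### The core inequality of a twin -/

/-- **Core inequality.** Under hA and hH, a Siegel constant `C` for the exponent `ε`, a twin `d`
of level `N = 2^n` (`n ≥ 2`) with `q = 4|d| < N` satisfies
`N · C q^{−ε} ≤ (n+1)(√N + 1) + 5√(qN) + 1`. -/
theorem core
    (hA : ∀ (d : ℤ) (x : ℕ), (∀ p : ℕ, p.Prime → p ≠ 2 → p ≤ x → jacobiSym d p = -1) →
      ∀ χ : DirichletCharacter ℂ (4 * d.natAbs), (∀ n : ℕ, Odd n → χ n = (jacobiSym d n : ℂ)) →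
      ∀ N : ℕ, N ≤ x →
        ‖∑ m ∈ Finset.Icc 1 N, ∑ e ∈ m.divisors, χ e‖ ≤ ((Nat.log 2 N + 1) * (Nat.sqrt N + 1) : ℕ))
    (hH : ∀ (q : ℕ) [NeZero q] (χ : DirichletCharacter ℂ q), χ ≠ 1 → ∀ B : ℝ,
      (∀ M : ℕ, ‖Literature.NumberTheory.LFunctions.DirichletAbel.partialSum χ M‖ ≤ B) →
      ∀ N Y : ℕ, 1 ≤ Y → Y ≤ N →
        ‖(∑ m ∈ Finset.Icc 1 N, ∑ e ∈ m.divisors, χ e) - (N : ℂ) * χ.LFunction 1‖ ≤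
          4 * B * N / Y + Y)
    {ε C : ℝ} (hC : ∀ (q : ℕ) [NeZero q] (χ : DirichletCharacter ℂ q),
      χ ^ 2 = 1 → χ ≠ 1 → C * (q : ℝ) ^ (-ε) ≤ (χ.LFunction 1).re)
    {n : ℕ} (hn : 2 ≤ n) {d : ℤ}
    (hd : ∀ p : ℕ, p.Prime → p ≠ 2 → p ≤ 2 ^ n → jacobiSym d p = -1)
    (hq : 4 * d.natAbs < 2 ^ n) :
    ((2 ^ n : ℕ) : ℝ) * (C * ((4 * d.natAbs : ℕ) : ℝ) ^ (-ε)) ≤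
      (n + 1) * (Real.sqrt ((2 ^ n : ℕ) : ℝ) + 1) +
        5 * Real.sqrt (((4 * d.natAbs : ℕ) : ℝ) * ((2 ^ n : ℕ) : ℝ)) + 1 := by
  have hN3 : 3 ≤ 2 ^ n :=
    le_trans (by norm_num) (Nat.pow_le_pow_right (by norm_num) hn : 2 ^ 2 ≤ 2 ^ n)
  have hd0 : d ≠ 0 := ne_zero_of_twin hd hN3
  haveI : NeZero (4 * d.natAbs) := ⟨mul_ne_zero (by norm_num) (Int.natAbs_ne_zero.mpr hd0)⟩
  obtain ⟨χ, hχ⟩ := exists_dirichletCharacter_four_mul d hd0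
  have hχ1 : χ ≠ 1 := chi_ne_one hd hN3 hχ
  have hχ2 : χ ^ 2 = 1 := chi_sq_eq_one hd0 hχ
  -- Siegel
  have hS : C * ((4 * d.natAbs : ℕ) : ℝ) ^ (-ε) ≤ (χ.LFunction 1).re := hC (4 * d.natAbs) χ hχ2 hχ1
  -- hA at `x = N = 2^n`
  have hA' := hA d (2 ^ n) hd χ hχ (2 ^ n) le_rfl
  rw [Nat.log_pow (by norm_num) n] at hA'
  -- hH at `B = q`, `Y = ⌊√(qN)⌋ + 1`
  have hY1 : 1 ≤ Nat.sqrt (4 * d.natAbs * 2 ^ n) + 1 := Nat.le_add_left 1 _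
  have hYN : Nat.sqrt (4 * d.natAbs * 2 ^ n) + 1 ≤ 2 ^ n :=
    Nat.succ_le_of_lt (Nat.sqrt_lt.2 (Nat.mul_lt_mul_of_pos_right hq (Nat.two_pow_pos n)))
  have hH' := hH (4 * d.natAbs) χ hχ1 ((4 * d.natAbs : ℕ) : ℝ)
    (DirichletAbel.norm_partialSum_le χ hχ1) (2 ^ n) (Nat.sqrt (4 * d.natAbs * 2 ^ n) + 1) hY1 hYN
  have hH'' := hH'.trans (hyperbola_error_le (4 * d.natAbs) (2 ^ n))
  -- ‖S‖ ≤ (n+1)(√N + 1)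
  have hsq : ((Nat.sqrt (2 ^ n) : ℕ) : ℝ) + 1 ≤ Real.sqrt ((2 ^ n : ℕ) : ℝ) + 1 :=
    add_le_add Real.nat_sqrt_le_real_sqrt le_rfl
  have hA'' : ‖∑ m ∈ Finset.Icc 1 (2 ^ n : ℕ), ∑ e ∈ m.divisors, χ e‖ ≤
      ((n : ℝ) + 1) * (Real.sqrt ((2 ^ n : ℕ) : ℝ) + 1) := by
    refine hA'.trans ?_
    simp only [Nat.cast_mul, Nat.cast_add, Nat.cast_one]
    exact mul_le_mul_of_nonneg_left hsq (by positivity)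
  -- combine: `N · C q^{-ε} ≤ N · re L ≤ ‖S‖ + ‖S − N·L‖`
  have hre := natCast_mul_re_le (2 ^ n) (∑ m ∈ Finset.Icc 1 (2 ^ n : ℕ), ∑ e ∈ m.divisors, χ e)
    (χ.LFunction 1)
  have hmul : ((2 ^ n : ℕ) : ℝ) * (C * ((4 * d.natAbs : ℕ) : ℝ) ^ (-ε)) ≤
      ((2 ^ n : ℕ) : ℝ) * (χ.LFunction 1).re := mul_le_mul_of_nonneg_left hS (Nat.cast_nonneg _)
  linarith

/-! ### Exponential beats linear -/

/-- For `0 ≤ c < 1`, `C > 0`, `ε = (1−c)/4`: eventually in `n`, for every `Q ∈ [4, 4·2^{cn}]`,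
`(n+1)(√(2^n) + 1) + 5√(Q·2^n) + 1 < 2^n · C Q^{−ε}`. -/
theorem eventually_lt {c C : ℝ} (hc0 : 0 ≤ c) (hc1 : c < 1) (hC : 0 < C) :
    ∀ᶠ n : ℕ in atTop, ∀ Q : ℝ, 4 ≤ Q → Q ≤ 4 * (2 : ℝ) ^ (c * (n : ℝ)) →
      ((n : ℝ) + 1) * (Real.sqrt ((2 : ℝ) ^ n) + 1) + 5 * Real.sqrt (Q * (2 : ℝ) ^ n) + 1 <
        (2 : ℝ) ^ n * (C * Q ^ (-((1 - c) / 4))) := by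
  set ε : ℝ := (1 - c) / 4 with hε
  set δ : ℝ := 1 - c * ε - (1 + c) / 2 with hδ
  have hε0 : 0 < ε := by rw [hε]; linarith
  have hδ0 : 0 < δ := by
    have : δ = (1 - c) * (2 - c) / 4 := by rw [hδ, hε]; ring
    rw [this]
    exact div_pos (mul_pos (by linarith) (by linarith)) (by norm_num)
  set C' : ℝ := C * (2 : ℝ) ^ (-2 * ε) with hC'
  have hC'0 : 0 < C' := mul_pos hC (Real.rpow_pos_of_pos two_pos _)
  have hlog : 0 < δ * Real.log 2 := mul_pos hδ0 (Real.log_pos one_lt_two)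
  -- exponential beats linear: eventually `2n + 13 < C' 2^{δ n}`
  have hev : ∀ᶠ n : ℕ in atTop, (2 * (n : ℝ) + 13) < C' * (2 : ℝ) ^ (δ * (n : ℝ)) := by
    have ht := ((tendsto_exp_mul_div_rpow_atTop 1 (δ * Real.log 2) hlog).comp
      tendsto_natCast_atTop_atTop).eventually_gt_atTop (3 / C')
    filter_upwards [ht, eventually_ge_atTop 13] with n hn hn13
    have hn0 : (0 : ℝ) < (n : ℝ) := by exact_mod_cast (lt_of_lt_of_le (by norm_num) hn13)
    have hexp : Real.exp (δ * Real.log 2 * (n : ℝ)) = (2 : ℝ) ^ (δ * (n : ℝ)) := by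
      rw [Real.rpow_def_of_pos two_pos]
      congr 1
      ring
    have h1 : 3 / C' < (2 : ℝ) ^ (δ * (n : ℝ)) / (n : ℝ) := by
      have := hn
      simp only [Function.comp_apply, Real.rpow_one] at this
      rwa [hexp] at this
    rw [div_lt_div_iff₀ hC'0 hn0] at h1
    have h13 : (13 : ℝ) ≤ (n : ℝ) := by exact_mod_cast hn13
    linarith
  filter_upwards [hev] with n hn Q hQ4 hQle
  -- notation: t = n, E = 2^{(1+c)t/2}
  have ht0 : (0 : ℝ) ≤ (n : ℝ) := Nat.cast_nonneg n
  have hQ0 : 0 < Q := lt_of_lt_of_le (by norm_num) hQ4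
  have h2t : (2 : ℝ) ^ n = (2 : ℝ) ^ (n : ℝ) := (Real.rpow_natCast 2 n).symm
  set E : ℝ := (2 : ℝ) ^ ((1 + c) * (n : ℝ) / 2) with hE
  have hE0 : 0 < E := Real.rpow_pos_of_pos two_pos _
  have hE1 : 1 ≤ E :=
    Real.one_le_rpow one_le_two (div_nonneg (mul_nonneg (by linarith) ht0) two_pos.le)
  -- √(2^n) ≤ E
  have hsqrtN : Real.sqrt ((2 : ℝ) ^ n) ≤ E := by
    rw [h2t, Real.sqrt_eq_rpow, ← Real.rpow_mul two_pos.le]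
    refine Real.rpow_le_rpow_of_exponent_le one_le_two ?_
    have := mul_nonneg hc0 ht0
    linarith
  -- √(Q 2^n) ≤ 2E
  have hEE : (2 * E) ^ 2 = 4 * (2 : ℝ) ^ (c * (n : ℝ)) * (2 : ℝ) ^ (n : ℝ) := by
    have : E * E = (2 : ℝ) ^ (c * (n : ℝ)) * (2 : ℝ) ^ (n : ℝ) := by
      rw [hE, ← Real.rpow_add two_pos, ← Real.rpow_add two_pos]
      congr 1
      ring
    calc (2 * E) ^ 2 = 4 * (E * E) := by ring
      _ = _ := by rw [this]; ring
  have hsqrtQ : Real.sqrt (Q * (2 : ℝ) ^ n) ≤ 2 * E := by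
    rw [h2t]
    calc Real.sqrt (Q * (2 : ℝ) ^ (n : ℝ))
        ≤ Real.sqrt (4 * (2 : ℝ) ^ (c * (n : ℝ)) * (2 : ℝ) ^ (n : ℝ)) :=
          Real.sqrt_le_sqrt (mul_le_mul_of_nonneg_right hQle (Real.rpow_nonneg two_pos.le _))
      _ = 2 * E := by rw [← hEE, Real.sqrt_sq (mul_nonneg two_pos.le hE0.le)]
  -- the lower bound: 2^n · C · Q^{-ε} ≥ C' 2^{δ n} E
  have hlow : C' * (2 : ℝ) ^ (δ * (n : ℝ)) * E ≤ (2 : ℝ) ^ n * (C * Q ^ (-ε)) := by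
    have hQe : (4 * (2 : ℝ) ^ (c * (n : ℝ))) ^ (-ε) ≤ Q ^ (-ε) :=
      Real.rpow_le_rpow_of_nonpos hQ0 hQle (by linarith)
    have h4 : (4 : ℝ) * (2 : ℝ) ^ (c * (n : ℝ)) = (2 : ℝ) ^ (c * (n : ℝ) + 2) := by
      rw [Real.rpow_add two_pos, Real.rpow_two]
      ring
    have hpow : (4 * (2 : ℝ) ^ (c * (n : ℝ))) ^ (-ε) = (2 : ℝ) ^ ((c * (n : ℝ) + 2) * (-ε)) := by
      rw [h4, ← Real.rpow_mul two_pos.le]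
    have hprod : C' * (2 : ℝ) ^ (δ * (n : ℝ)) * E =
        (2 : ℝ) ^ n * (C * (2 : ℝ) ^ ((c * (n : ℝ) + 2) * (-ε))) := by
      rw [hC', hE, h2t]
      have : (2 : ℝ) ^ (-2 * ε) * (2 : ℝ) ^ (δ * (n : ℝ)) * (2 : ℝ) ^ ((1 + c) * (n : ℝ) / 2) =
          (2 : ℝ) ^ (n : ℝ) * (2 : ℝ) ^ ((c * (n : ℝ) + 2) * (-ε)) := by
        rw [← Real.rpow_add two_pos, ← Real.rpow_add two_pos, ← Real.rpow_add two_pos]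
        congr 1
        rw [hδ]
        ring
      calc C * (2 : ℝ) ^ (-2 * ε) * (2 : ℝ) ^ (δ * (n : ℝ)) * (2 : ℝ) ^ ((1 + c) * (n : ℝ) / 2)
          = C * ((2 : ℝ) ^ (-2 * ε) * (2 : ℝ) ^ (δ * (n : ℝ)) *
              (2 : ℝ) ^ ((1 + c) * (n : ℝ) / 2)) := by ring
        _ = (2 : ℝ) ^ (n : ℝ) * (C * (2 : ℝ) ^ ((c * (n : ℝ) + 2) * (-ε))) := by rw [this]; ring
    rw [hprod, ← hpow]
    have h2n : (0 : ℝ) ≤ (2 : ℝ) ^ n := by positivity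
    exact mul_le_mul_of_nonneg_left (mul_le_mul_of_nonneg_left hQe hC.le) h2n
  -- the upper bound: LHS ≤ (2n + 13) E
  have hup : ((n : ℝ) + 1) * (Real.sqrt ((2 : ℝ) ^ n) + 1) + 5 * Real.sqrt (Q * (2 : ℝ) ^ n) + 1 ≤
      (2 * (n : ℝ) + 13) * E := by
    have hn1 : (0 : ℝ) ≤ (n : ℝ) + 1 := by positivity
    have h1 : ((n : ℝ) + 1) * (Real.sqrt ((2 : ℝ) ^ n) + 1) ≤ ((n : ℝ) + 1) * (E + E) :=
      mul_le_mul_of_nonneg_left (add_le_add hsqrtN hE1) hn1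
    linarith
  -- conclude
  have hfin : (2 * (n : ℝ) + 13) * E < C' * (2 : ℝ) ^ (δ * (n : ℝ)) * E :=
    mul_lt_mul_of_pos_right hn hE0
  linarith

/-- The stub for `0 ≤ c < 1`. -/
theorem of_nonneg
    (hA : ∀ (d : ℤ) (x : ℕ), (∀ p : ℕ, p.Prime → p ≠ 2 → p ≤ x → jacobiSym d p = -1) →
      ∀ χ : DirichletCharacter ℂ (4 * d.natAbs), (∀ n : ℕ, Odd n → χ n = (jacobiSym d n : ℂ)) →
      ∀ N : ℕ, N ≤ x →
        ‖∑ m ∈ Finset.Icc 1 N, ∑ e ∈ m.divisors, χ e‖ ≤ ((Nat.log 2 N + 1) * (Nat.sqrt N + 1) : ℕ))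
    (hH : ∀ (q : ℕ) [NeZero q] (χ : DirichletCharacter ℂ q), χ ≠ 1 → ∀ B : ℝ,
      (∀ M : ℕ, ‖Literature.NumberTheory.LFunctions.DirichletAbel.partialSum χ M‖ ≤ B) →
      ∀ N Y : ℕ, 1 ≤ Y → Y ≤ N →
        ‖(∑ m ∈ Finset.Icc 1 N, ∑ e ∈ m.divisors, χ e) - (N : ℂ) * χ.LFunction 1‖ ≤
          4 * B * N / Y + Y)
    {c : ℝ} (hc0 : 0 ≤ c) (hc1 : c < 1) :
    ∀ᶠ n : ℕ in Filter.atTop, ∀ d : ℤ, (|d| : ℝ) ≤ 2 ^ (c * n) →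
      ¬ ∀ p : ℕ, p.Prime → p ≠ 2 → p ≤ 2 ^ n → jacobiSym d p = -1 := by
  have hε0 : 0 < (1 - c) / 4 := by linarith
  obtain ⟨C, hC0, hC⟩ := Siegel.siegel_theorem_quadratic hε0
  -- eventually `c n + 2 < n`
  have hev2 : ∀ᶠ n : ℕ in atTop, c * (n : ℝ) + 2 < (n : ℝ) := by
    have ht : Tendsto (fun n : ℕ => (1 - c) * (n : ℝ)) atTop atTop :=
      Tendsto.const_mul_atTop (by linarith) tendsto_natCast_atTop_atTop
    filter_upwards [ht.eventually_gt_atTop 2] with n hn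
    linarith
  filter_upwards [eventually_ge_atTop 2, hev2, eventually_lt hc0 hc1 hC0] with n hn2 hn hkey
  intro d hdle hd
  have hN3 : 3 ≤ 2 ^ n :=
    le_trans (by norm_num) (Nat.pow_le_pow_right (by norm_num) hn2 : 2 ^ 2 ≤ 2 ^ n)
  have hd0 : d ≠ 0 := ne_zero_of_twin hd hN3
  -- `q = 4|d|` as a real number
  have hqR : ((4 * d.natAbs : ℕ) : ℝ) = 4 * |(d : ℝ)| := by
    simp [Nat.cast_natAbs, Int.cast_abs]
  have hdabs : |(d : ℝ)| ≤ (2 : ℝ) ^ (c * (n : ℝ)) := hdle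
  have hq4 : (4 : ℝ) ≤ ((4 * d.natAbs : ℕ) : ℝ) := by
    have : (1 : ℝ) ≤ |(d : ℝ)| := by
      rw [← Int.cast_abs]
      exact_mod_cast Int.one_le_abs hd0
    rw [hqR]
    linarith
  have hqle : ((4 * d.natAbs : ℕ) : ℝ) ≤ 4 * (2 : ℝ) ^ (c * (n : ℝ)) := by
    rw [hqR]
    linarith
  -- `q < N`
  have h2n : ((2 ^ n : ℕ) : ℝ) = (2 : ℝ) ^ n := by norm_num
  have hqlt : 4 * d.natAbs < 2 ^ n := by
    have h4 : (4 : ℝ) * (2 : ℝ) ^ (c * (n : ℝ)) = (2 : ℝ) ^ (c * (n : ℝ) + 2) := by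
      rw [Real.rpow_add two_pos, Real.rpow_two]
      ring
    have hlt : (2 : ℝ) ^ (c * (n : ℝ) + 2) < (2 : ℝ) ^ ((n : ℕ) : ℝ) :=
      Real.rpow_lt_rpow_of_exponent_lt one_lt_two hn
    rw [Real.rpow_natCast] at hlt
    have : ((4 * d.natAbs : ℕ) : ℝ) < ((2 ^ n : ℕ) : ℝ) := by
      rw [h2n]
      linarith
    exact_mod_cast this
  have hcore := core hA hH (ε := (1 - c) / 4) hC hn2 hd hqlt
  have hk := hkey (((4 * d.natAbs : ℕ) : ℝ)) hq4 hqle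
  rw [h2n] at hcore
  linarith

end TwinFreeSublinear

/-- **STUB T2c · `stub_twinFreeSublinear`** — NO TWIN OF LEVEL `2^n` HAS FEWER THAN `c·n` BITS
(`c < 1`), EVENTUALLY IN `n`, UNCONDITIONALLY (given T2a = hA and T2b = hH as hypotheses): with
`N = 2^n`, `q = 4|d| ≤ 4·2^{cn}`, the Kronecker character `χ` mod `q`
(`exists_dirichletCharacter_four_mul`; quadratic by `isQuadratic_of_forall_odd`; `χ ≠ 1` since
`χ(3) = −1`), the trivial bound `B = q` (`DirichletAbel.norm_partialSum_le`) and
`Y = ⌊√(qN)⌋ + 1`: hH gives `‖∑ − N·L(1,χ)‖ ≤ 5√(qN) + 1`, Siegel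
(`Siegel.siegel_theorem_quadratic`, `ε = (1−c)/4`) gives `re L(1,χ) ≥ C q^{−ε}`, and hA gives
`‖∑‖ ≤ (n+1)(√(2^n)+1)`: impossible for large `n`. Negative `c` reduces to `c = 0`. -/
theorem stub_twinFreeSublinear :
    (∀ (d : ℤ) (x : ℕ), (∀ p : ℕ, p.Prime → p ≠ 2 → p ≤ x → jacobiSym d p = -1) →
      ∀ χ : DirichletCharacter ℂ (4 * d.natAbs), (∀ n : ℕ, Odd n → χ n = (jacobiSym d n : ℂ)) →
      ∀ N : ℕ, N ≤ x →
        ‖∑ m ∈ Finset.Icc 1 N, ∑ e ∈ m.divisors, χ e‖ ≤ ((Nat.log 2 N + 1) * (Nat.sqrt N + 1) : ℕ)) →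
    (∀ (q : ℕ) [NeZero q] (χ : DirichletCharacter ℂ q), χ ≠ 1 → ∀ B : ℝ,
      (∀ M : ℕ, ‖Literature.NumberTheory.LFunctions.DirichletAbel.partialSum χ M‖ ≤ B) →
      ∀ N Y : ℕ, 1 ≤ Y → Y ≤ N →
        ‖(∑ m ∈ Finset.Icc 1 N, ∑ e ∈ m.divisors, χ e) - (N : ℂ) * χ.LFunction 1‖ ≤
          4 * B * N / Y + Y) →
    ∀ c : ℝ, c < 1 → ∀ᶠ n : ℕ in Filter.atTop, ∀ d : ℤ, (|d| : ℝ) ≤ 2 ^ (c * n) →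
      ¬ ∀ p : ℕ, p.Prime → p ≠ 2 → p ≤ 2 ^ n → jacobiSym d p = -1 := by
  intro hA hH c hc
  have h0 : 0 ≤ max c 0 := le_max_right c 0
  have h1 : max c 0 < 1 := max_lt hc one_pos
  filter_upwards [TwinFreeSublinear.of_nonneg hA hH h0 h1] with n hn d hd
  refine hn d (hd.trans ?_)
  exact Real.rpow_le_rpow_of_exponent_le one_le_two
    (mul_le_mul_of_nonneg_right (le_max_left c 0) (Nat.cast_nonneg n))

end Summit.QuantumAdvantage.QuantumAdvantage.Theorems.LiouvilleNotPPoly
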